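import Mathlib.Analysis.Calculus.DifferentialForm.Basic
import Mathlib.Analysis.Calculus.FDeriv.Prod
import Literature.Geometry.Kaehler.PoincareLemmaFlat
import HarnessLib

/-!
# The first variation of the pull-back of a differential form along a family of maps

Topic `Literature/Analysis/Calculus` (flat differential forms, Mathlib's `extDeriv`). Theorems
only. Let `ψ : P × M → T` be a `C²` family of maps `ψ_t = ψ (t, ·) : M → T` between real normed
spaces, parametrised by `t ∈ P`, and `ξ` a differentiable `(k+1)`-form on `T`. The classical
**variation formula** (Cartan's formula for a time-dependent family of maps; the infinitesimal form
of the homotopy formula, Bott–Tu (1982), §I.4; Warner (1983), 4.18; Lee (2013), Prop. 14.35) reads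

  `∂/∂t (ψ_t^* ξ)(y) · h = d (ψ_t^* (ι_{Ŷ_h} ξ)) (y) + ψ_t^* (ι_{Ŷ_h} dξ) (y)`,

where `Ŷ_h (y) = ∂ψ/∂t (t, y) · h` is the variation field along `ψ_t` and the "pull-backs along
`ψ_t` of the forms contracted with a field along `ψ_t`" are, by definition,
`y ↦ (ξ (ψ_t y)) (Ŷ_h y, dψ_t ·, …, dψ_t ·)`. We prove it in two forms:

* `fderiv_pullback_prod_slice` — with the total pull-back `Ω = ψ^* ξ` on `P × M` and the slice
  inclusions `y ↦ (t, y)` (derivative `inr`): the `t`-derivative of the slice restriction of `Ω`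
  in the direction `h` is `d (j_t^* ι_{(h,0)} Ω) + j_t^* ι_{(h,0)} dΩ`, and `dΩ = ψ^* dξ`;
* `fderiv_pullback_family` — the displayed formula, with partial derivatives.

Proof: the `t`-derivative of `j_t^* Ω` is the directional derivative `D_{(h,0)} Ω` restricted to
the slice; Cartan's formula for the CONSTANT field `a = (h, 0)` on `P × M`,
`D_a Ω = d (ι_a Ω) + ι_a dΩ`, is the tree's algebraic identity
`Literature.Geometry.Kaehler.alternatizeUncurryFin_add_curryLeft` (file `PoincareLemmaFlat`); `d`
commutes with the pull-backs along `ψ` and along the affine slice `j_t` (Mathlib's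
`extDeriv_pullback`).

## References

* R. Bott, L. W. Tu, *Differential Forms in Algebraic Topology* (1982), §I.4. [BottTu1982Forms]
* F. W. Warner, *Foundations of Differentiable Manifolds and Lie Groups* (1983), 4.18.
* C. Voisin, *Hodge Theory and Complex Algebraic Geometry I* (2002), Prop. 9.14, formula (9.8)
  (the Gauss–Manin derivative of the class of a family of fibre restrictions). [VoisinHodgeI2002]
-/

noncomputable section

open Set Filter Function Topology ContinuousAlternatingMap

namespace Literature.Analysis.Calculus

variable {EP : Type*} [NormedAddCommGroup EP] [NormedSpace ℝ EP]
  {EM : Type*} [NormedAddCommGroup EM] [NormedSpace ℝ EM]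
  {ET : Type*} [NormedAddCommGroup ET] [NormedSpace ℝ ET]
  {F : Type*} [NormedAddCommGroup F] [NormedSpace ℝ F] {k : ℕ}

/-! ### Auxiliary identities

(Naturality of the interior product under precomposition, `ι_w (f^*η) = f^*(ι_{f w} η)`, is
Mathlib's `ContinuousAlternatingMap.curryLeft_compContinuousLinearMap`.) -/

/-- Associativity of precomposition: `(η ∘ f) ∘ g = η ∘ (f ∘ g)`. [folklore] -/
theorem compContinuousLinearMap_compContinuousLinearMap {E E' E'' : Type*} [NormedAddCommGroup E]
    [NormedSpace ℝ E] [NormedAddCommGroup E'] [NormedSpace ℝ E'] [NormedAddCommGroup E'']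
    [NormedSpace ℝ E''] {l : ℕ} (η : E'' [⋀^Fin l]→L[ℝ] F) (f : E' →L[ℝ] E'') (g : E →L[ℝ] E') :
    (η.compContinuousLinearMap f).compContinuousLinearMap g = η.compContinuousLinearMap (f.comp g) := by
  ext v
  simp [compContinuousLinearMap_apply, Function.comp_def]

/-- Precomposition is additive in the form. [folklore] -/
theorem add_compContinuousLinearMap' {E E' : Type*} [NormedAddCommGroup E] [NormedSpace ℝ E]
    [NormedAddCommGroup E'] [NormedSpace ℝ E'] {l : ℕ} (η η' : E' [⋀^Fin l]→L[ℝ] F)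
    (f : E →L[ℝ] E') :
    (η + η').compContinuousLinearMap f = η.compContinuousLinearMap f + η'.compContinuousLinearMap f := by
  ext v
  simp [compContinuousLinearMap_apply]

/-- The continuous linear map `η ↦ ι_a η`. [folklore] -/
theorem exists_clm_curryLeft {E : Type*} [NormedAddCommGroup E] [NormedSpace ℝ E] (a : E) :
    ∃ C : (E [⋀^Fin (k + 1)]→L[ℝ] F) →L[ℝ] (E [⋀^Fin k]→L[ℝ] F), ∀ η, C η = η.curryLeft a :=
  ⟨(ContinuousLinearMap.apply ℝ _ a).comp
    (curryLeftLI (𝕜 := ℝ) (E := E) (F := F) (n := k)).toContinuousLinearMap, fun _ ↦ rfl⟩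

/-! ### The variation formula on the product -/

/-- **First variation of the pull-back, product form.** For a `C²` family `ψ : P × M → T` and a
`(k+1)`-form `ξ` differentiable at `ψ (t, y)`, with total pull-back
`Ω z = (ξ (ψ z)) ∘ dψ_z` on `P × M` and slice inclusion `j_t y = (t, y)` (`d j_t = inr`): the map
`t' ↦ j_{t'}^* Ω (y)` is differentiable at `t` and its derivative in the direction `h` is
`d (j_t^* ι_{(h,0)} Ω) (y) + j_t^* ι_{(h,0)} (ψ^* dξ) (y)` (Cartan's formula for the constant field
`(h, 0)`, `Literature.Geometry.Kaehler.alternatizeUncurryFin_add_curryLeft`, with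
`dΩ = ψ^* dξ`, Mathlib `extDeriv_pullback`). [cite: BottTu1982Forms, §I.4] -/
theorem fderiv_pullback_prod_slice {ψ : EP × EM → ET} {ξ : ET → ET [⋀^Fin (k + 1)]→L[ℝ] F}
    {t : EP} {y : EM} (hψ : ContDiffAt ℝ 2 ψ (t, y)) (hξ : DifferentiableAt ℝ ξ (ψ (t, y)))
    (h : EP) :
    DifferentiableAt ℝ (fun t' ↦ ((ξ (ψ (t', y))).compContinuousLinearMap
      (fderiv ℝ ψ (t', y))).compContinuousLinearMap (ContinuousLinearMap.inr ℝ EP EM)) t ∧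
    fderiv ℝ (fun t' ↦ ((ξ (ψ (t', y))).compContinuousLinearMap
        (fderiv ℝ ψ (t', y))).compContinuousLinearMap (ContinuousLinearMap.inr ℝ EP EM)) t h =
      extDeriv (fun y' ↦ (((ξ (ψ (t, y'))).compContinuousLinearMap (fderiv ℝ ψ (t, y'))).curryLeft
          (h, 0)).compContinuousLinearMap (ContinuousLinearMap.inr ℝ EP EM)) y +
        (((extDeriv ξ (ψ (t, y))).compContinuousLinearMap (fderiv ℝ ψ (t, y))).curryLeft
          (h, 0)).compContinuousLinearMap (ContinuousLinearMap.inr ℝ EP EM) := by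
  -- notation
  set Ω : EP × EM → (EP × EM) [⋀^Fin (k + 1)]→L[ℝ] F :=
    fun z ↦ (ξ (ψ z)).compContinuousLinearMap (fderiv ℝ ψ z) with hΩ
  set z₀ : EP × EM := (t, y) with hz₀
  set a : EP × EM := (h, 0) with ha
  set inr := ContinuousLinearMap.inr ℝ EP EM with hinr
  -- differentiability of `Ω` at `z₀`
  have hψd : DifferentiableAt ℝ ψ z₀ := hψ.differentiableAt (by simp)
  have hDψ : DifferentiableAt ℝ (fderiv ℝ ψ) z₀ :=
    (hψ.fderiv_right (m := 1) (by norm_num)).differentiableAt one_ne_zero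
  have hΩd : DifferentiableAt ℝ Ω z₀ :=
    (hξ.comp z₀ hψd).continuousAlternatingMapCompContinuousLinearMap hDψ
  -- Step 1: the `t`-derivative of the slice restriction is `(D_{(h,0)} Ω) ∘ inr`
  set R : ((EP × EM) [⋀^Fin (k + 1)]→L[ℝ] F) →L[ℝ] (EM [⋀^Fin (k + 1)]→L[ℝ] F) :=
    compContinuousLinearMapCLM inr with hR
  have hcurve : HasFDerivAt (fun t' : EP ↦ (t', y)) (ContinuousLinearMap.inl ℝ EP EM) t :=
    hasFDerivAt_prodMk_left t y
  have hΩd' : HasFDerivAt Ω (fderiv ℝ Ω z₀) ((fun t' : EP ↦ (t', y)) t) := hΩd.hasFDerivAt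
  have hinner : HasFDerivAt (Ω ∘ fun t' : EP ↦ (t', y))
      ((fderiv ℝ Ω z₀).comp (ContinuousLinearMap.inl ℝ EP EM)) t := hΩd'.comp t hcurve
  have hG : HasFDerivAt (⇑R ∘ (Ω ∘ fun t' : EP ↦ (t', y))) (R.comp ((fderiv ℝ Ω z₀).comp
      (ContinuousLinearMap.inl ℝ EP EM))) t :=
    R.hasFDerivAt.comp t hinner
  have hGeq : (fun t' ↦ ((ξ (ψ (t', y))).compContinuousLinearMap (fderiv ℝ ψ (t', y))).compContinuousLinearMap inr) =
      ⇑R ∘ (Ω ∘ fun t' : EP ↦ (t', y)) := rfl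
  refine ⟨by rw [hGeq]; exact hG.differentiableAt, ?_⟩
  rw [hGeq, hG.fderiv]
  simp only [ContinuousLinearMap.coe_comp, Function.comp_apply, ContinuousLinearMap.inl_apply]
  change (fderiv ℝ Ω z₀ a).compContinuousLinearMap inr = _
  -- Step 2: Cartan's formula for the constant field `a`
  obtain ⟨C, hC⟩ := exists_clm_curryLeft (E := EP × EM) (F := F) (k := k) a
  have hιΩ : (fun z ↦ (Ω z).curryLeft a) = ⇑C ∘ Ω := funext fun z ↦ (hC _).symm
  have hιΩd : DifferentiableAt ℝ (fun z ↦ (Ω z).curryLeft a) z₀ := by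
    rw [hιΩ]; exact C.differentiableAt.comp z₀ hΩd
  have hP : ∀ v, fderiv ℝ (fun z ↦ (Ω z).curryLeft a) z₀ v = (fderiv ℝ Ω z₀ v).curryLeft a := by
    intro v
    rw [hιΩ, (C.hasFDerivAt.comp z₀ hΩd.hasFDerivAt).fderiv]
    simp [hC]
  have hcartan := Literature.Geometry.Kaehler.alternatizeUncurryFin_add_curryLeft
    (f := fderiv ℝ Ω z₀) (P := fderiv ℝ (fun z ↦ (Ω z).curryLeft a) z₀) (w := a) hP
  -- `Alt (D(ι_a Ω)) = d(ι_a Ω)`, `Alt (DΩ) = dΩ`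
  change extDeriv (fun z ↦ (Ω z).curryLeft a) z₀ + (extDeriv Ω z₀).curryLeft a = fderiv ℝ Ω z₀ a
    at hcartan
  rw [← hcartan, add_compContinuousLinearMap']
  -- Step 3: `dΩ = ψ^* dξ`
  have hdΩ : extDeriv Ω z₀ = (extDeriv ξ (ψ z₀)).compContinuousLinearMap (fderiv ℝ ψ z₀) :=
    extDeriv_pullback hξ hψ (by simp)
  rw [hdΩ]
  -- Step 4: `d` commutes with the slice pull-back `j_t^*`
  congr 1
  have hslice : ∀ y', fderiv ℝ (fun y'' : EM ↦ (t, y'')) y' = inr := fun y' ↦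
    (hasFDerivAt_prodMk_right t y').fderiv
  have hf2 : ContDiffAt ℝ 2 (fun y' : EM ↦ (t, y')) y := contDiffAt_const.prodMk contDiffAt_id
  have hpull := extDeriv_pullback (𝕜 := ℝ) (ω := fun z ↦ (Ω z).curryLeft a)
    (f := fun y' : EM ↦ (t, y')) (x := y) (r := 2) hιΩd hf2 (by simp)
  simp only [hslice] at hpull
  exact hpull.symm

/-! ### The variation formula with partial derivatives -/

/-- Partial derivative in the second variable through the total derivative. [folklore] -/
theorem fderiv_curry_right_eq {ψ : EP × EM → ET} {t : EP} {y : EM}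
    (hψ : DifferentiableAt ℝ ψ (t, y)) :
    fderiv ℝ (fun y' ↦ ψ (t, y')) y = (fderiv ℝ ψ (t, y)).comp (ContinuousLinearMap.inr ℝ EP EM) :=
  (hψ.hasFDerivAt.comp y (hasFDerivAt_prodMk_right t y)).fderiv

/-- Partial derivative in the first variable through the total derivative. [folklore] -/
theorem fderiv_curry_left_apply_eq {ψ : EP × EM → ET} {t : EP} {y : EM}
    (hψ : DifferentiableAt ℝ ψ (t, y)) (h : EP) :
    fderiv ℝ (fun t' ↦ ψ (t', y)) t h = fderiv ℝ ψ (t, y) (h, 0) := by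
  have hd : HasFDerivAt (fun t' ↦ ψ (t', y))
      ((fderiv ℝ ψ (t, y)).comp (ContinuousLinearMap.inl ℝ EP EM)) t :=
    hψ.hasFDerivAt.comp t (hasFDerivAt_prodMk_left t y)
  rw [hd.fderiv]
  simp

/-- **First variation of the pull-back of a form along a family of maps** (Cartan's formula for a
time-dependent family; Bott–Tu (1982), §I.4; Voisin (2002), Prop. 9.14 / formula (9.8)): for a
`C²` family `ψ : P × M → T` of maps `ψ_t = ψ (t, ·)` and a `(k+1)`-form `ξ` on `T` differentiable
at `ψ (t, y)`, the family of pull-backs `t' ↦ (ψ_{t'}^* ξ)(y) = ξ (ψ_{t'} y) ∘ dψ_{t'}(y)` is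
differentiable at `t`, with derivative in the direction `h`

  `d (ψ_t^* (ι_{Ŷ_h} ξ)) (y) + ψ_t^* (ι_{Ŷ_h (y)} dξ) (y)`,  `Ŷ_h (y') = ∂ψ/∂t (t, y') · h`,

where the pull-backs along `ψ_t` of forms contracted with the field `Ŷ_h` along `ψ_t` are
`y' ↦ (ξ (ψ_t y')) (Ŷ_h y', dψ_t(y') ·, …)`, resp. `(dξ (ψ_t y)) (Ŷ_h y, dψ_t(y) ·, …)`.
[cite: BottTu1982Forms, §I.4] [cite: VoisinHodgeI2002, Prop. 9.14] -/
theorem fderiv_pullback_family {ψ : EP × EM → ET} {ξ : ET → ET [⋀^Fin (k + 1)]→L[ℝ] F}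
    {t : EP} {y : EM} (hψ : ContDiffAt ℝ 2 ψ (t, y)) (hξ : DifferentiableAt ℝ ξ (ψ (t, y)))
    (h : EP) :
    DifferentiableAt ℝ (fun t' ↦ (ξ (ψ (t', y))).compContinuousLinearMap
      (fderiv ℝ (fun y' ↦ ψ (t', y')) y)) t ∧
    fderiv ℝ (fun t' ↦ (ξ (ψ (t', y))).compContinuousLinearMap
        (fderiv ℝ (fun y' ↦ ψ (t', y')) y)) t h =
      extDeriv (fun y' ↦ ((ξ (ψ (t, y'))).curryLeft (fderiv ℝ (fun t' ↦ ψ (t', y')) t h)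
          |>.compContinuousLinearMap (fderiv ℝ (fun y'' ↦ ψ (t, y'')) y'))) y +
        ((extDeriv ξ (ψ (t, y))).curryLeft (fderiv ℝ (fun t' ↦ ψ (t', y)) t h)
          |>.compContinuousLinearMap (fderiv ℝ (fun y' ↦ ψ (t, y')) y)) := by
  set inr := ContinuousLinearMap.inr ℝ EP EM with hinr
  obtain ⟨hdiff, hformula⟩ := fderiv_pullback_prod_slice hψ hξ h
  -- `ψ` is `C²`, hence differentiable, near `(t, y)`
  have hnear : ∀ᶠ z in 𝓝 (t, y), DifferentiableAt ℝ ψ z :=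
    (hψ.eventually (by simp)).mono fun z hz ↦ hz.differentiableAt (by simp)
  -- the two spellings of the family agree near `t`
  have hev₁ : (fun t' ↦ (ξ (ψ (t', y))).compContinuousLinearMap (fderiv ℝ (fun y' ↦ ψ (t', y')) y))
      =ᶠ[𝓝 t] fun t' ↦ (((ξ (ψ (t', y))).compContinuousLinearMap (fderiv ℝ ψ (t', y)))
        |>.compContinuousLinearMap inr) := by
    have hc : Tendsto (fun t' : EP ↦ (t', y)) (𝓝 t) (𝓝 (t, y)) :=
      (continuous_id.prodMk continuous_const).tendsto' t (t, y) rfl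
    filter_upwards [hc.eventually hnear] with t' ht'
    rw [compContinuousLinearMap_compContinuousLinearMap, ← fderiv_curry_right_eq ht']
  refine ⟨hdiff.congr_of_eventuallyEq hev₁, ?_⟩
  rw [hev₁.fderiv_eq, hformula]
  have hψd : DifferentiableAt ℝ ψ (t, y) := hψ.differentiableAt (by simp)
  congr 1
  · -- the exact term: the two integrands agree near `y`
    apply Filter.EventuallyEq.extDeriv_eq
    have hc : Tendsto (fun y' : EM ↦ (t, y')) (𝓝 y) (𝓝 (t, y)) :=
      (continuous_const.prodMk continuous_id).tendsto' y (t, y) rfl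
    filter_upwards [hc.eventually hnear] with y' hy'
    rw [curryLeft_compContinuousLinearMap, compContinuousLinearMap_compContinuousLinearMap,
      ← fderiv_curry_right_eq hy', fderiv_curry_left_apply_eq hy']
  · rw [curryLeft_compContinuousLinearMap, compContinuousLinearMap_compContinuousLinearMap,
      ← fderiv_curry_right_eq hψd, fderiv_curry_left_apply_eq hψd]

end Literature.Analysis.Calculus

end
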